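import Summits.QuantumFields.BalabanUV.T4Continuum.Support.TermwiseLevelsLedger
import Summits.QuantumFields.BalabanUV.T4Continuum.Support.TermwiseHolder

/-!
# TermwiseLevelsProfile — the level-graded one-step sandwich with a HÖLDER OSCILLATION PROFILE: the (U) bound per
level via generation 15's `interpolationSize_le_profile`, the two window sums of the census, and generation 9's six
binders PRODUCED under the window clause with the variance share at the slow rate `ϑ²`

Cell `pub-balaban`, rung (B)+1 sub-cell t4, lineage `b2b-balaban-t4-ne7-p1` (node U5 = NE7, TERM-WISE member;
generation 17), record `t4/T4-EST-NE7-P1.md` §23; continues `Support/TermwiseLevels(Ledger)` (ns `TermwiseLevels`).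
HONEST FRAMING (page 1): FIXED FINITE T⁴, rung (B)+1 = the `ε → 0` limit of unit-scale averaged expectations,
CONDITIONAL on BetaPertH and the nine spine estimates (0/9 proved); NOT infinite volume, NOT a mass gap, NOT the Clay
problem; NE7 NOT PRINTED in [Balaban1984PropagatorsI]–[Balaban1989LargeFieldII], NOT proved here.  [folklore]
finite-sum bookkeeping; no definitions, no cite tags; nothing printed is asserted.

WHY (record (22b)(1)).  The printed background regularity that the lineage reads ([Balaban1985Variational] Thm 1 (9)
with the `(1,β₀)`-Hölder norm of [Balaban1985BackgroundPropagators] (3.40), `0 < β₀ < 1`; generation 15–16's finding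
that the endpoint `β₀ = 1` is delivered by nothing in print) gives the window oscillation of the transported field at
level `j` only as `ω_j ≤ c₂ε₁L^{−2(j+1)}·(L^{−β₀})^j`, not `…·L^{−j}`.  Generation 15 handled this UNIFORMLY in `K`
(`TermwiseHolder`: the (U) majorant `∝ h_K²`, `h ∈ ℓ²`); `Support/TermwiseLevels(Ledger)` handled LEVEL GRADING at the
endpoint.  This module does both at once: level-graded radii with a geometric profile `ϑ^j` (`ϑ = L^{−β₀}`).  Under
the window clause the variance share sums to `windowSum ϑ² L⁴ (jlogOf Cl K) K = poly(K)·ϑ^{2K}` — summable for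
EVERY `0 < ϑ < 1` by the tree's `summable_windowSum_log` (no condition linking `ϑ` and `L⁴`: the logarithmic window is
what makes the slow Hölder rate affordable).

WHAT IS PROVED ([folklore]).
§12 `levelShareP_le` (ONE level, ONE CALL of `TermwiseHolder.interpolationSize_le_profile` at `a = L^{−j}`: share
    `≤ vol·μ·n₀·(c₂²ε₁²/4·h² + C₂·(L⁻²)^j)`, `C₂ = c₁c₃ε₁³ + q(c₁ε₁ + c₃ε₁²)⁴`); **`interpolationError_le_levels_profile`**
    (the heterogeneous (U) bound at one cutoff with `ω_j ≤ c₂ε₁L^{−2(j+1)}·h_j`: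
    `≤ vol·n₀·Σ_{j≤K} μ_j·(c₂²ε₁²/4·h_j² + C₂·(L⁻²)^j)`); `sum_shares_profile_le` (with the count shares of the window
    clause and `h_j = ϑ^j`: `≤ C₁·windowSum ϑ² Λ j⋆ K + C₂·windowSum θ Λ j⋆ K`).
§13 **`interpolation_averaging_of_levels_profile`** — `TermwiseLevels.interpolation_averaging_of_levels` with ONE binder
    re-typed, `hω : ω_j ≤ c₂ε₁L^{−2(j+1)}·ϑ^j` (`0 < ϑ < 1`); OUTPUT generation 9's six binders with
    `dU_K = n₀·(c₂²ε₁²/4·windowSum ϑ² L⁴ (jlogOf Cl K) K + C₂·windowSum L⁻² L⁴ (jlogOf Cl K) K)`,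
    `dL_K = n₀·C_L·windowSum L⁻² L⁴ (jlogOf Cl K) K` (unchanged), non-negative and summable.

BINDER STATUS: as `TermwiseLevelsLedger` ((win) = interface I-3, a definition; (sz)(bch)(osc)(scal) per level =
ESTIMATES located in shape at [Balaban1985Variational] (2)/(9), NOT PRINTED for two runs); the profile `ϑ` is the
Hölder exponent's, `ϑ = L^{−β₀}` in `Support/TermwiseLocalReg`.  NOT DELIVERED: anything about print; NOT NE7, NOT
summit progress.
-/

noncomputable section

open Finset _root_.Filter _root_.Topology
open scoped BigOperators

namespace Summit.QuantumFields.BalabanUV.T4Continuum.TermwiseLevels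

open Literature.MathematicalPhysics.QuantumFieldTheory.Balaban1983to89
open T4TermwiseQuartic TermwiseHeterogeneous
open T4GoodClassBudget (windowSum jlogOf summable_windowSum_log RecentOnly windowSum_nonneg jlogOf_le)
open TermwiseHolder (interpolationSize_le_profile)

/-! ## §12 The heterogeneous (U) bound at one cutoff WITH AN OSCILLATION PROFILE (Hölder exponent `β₀ < 1`) -/

section HeterogeneousP

variable {V : Type*} [NormedAddCommGroup V] [InnerProductSpace ℝ V] {X Y : Type*}

/-- **ONE LEVEL OF (U), RESCALED, PROFILE FORM** — generation 15's `interpolationSize_le_profile` at scale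
`a = L^{−j}` with the window oscillation `ω ≤ c₂ε₁L^{−2(j+1)}·h` (`h` the relative oscillation modulus of the level,
e.g. `(L^{−β₀})^j`), windows counted in units of the level-`j` lattice (`N·L^{−4j} ≤ n₀·vol·μ`): the level-`j` share of
the (U) error is `≤ vol·μ·n₀·(c₂²ε₁²/4·h² + C₂·(L⁻²)^j)`, `C₂ = c₁c₃ε₁³ + q(c₁ε₁ + c₃ε₁²)⁴` — the oscillation share
carries `h²` and NO power of `L^{−j}`. [folklore] -/
theorem levelShareP_le {q L n₀ vol c₁ c₂ c₃ ε₁ sz ω ρb N μ h : ℝ} (hq : 0 ≤ q) (hL : 1 < L) (hn₀ : 0 ≤ n₀)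
    (hvol : 0 ≤ vol) (hc₁ : 0 ≤ c₁) (hc₃ : 0 ≤ c₃) (hε₁ : 0 ≤ ε₁) (hμ : 0 ≤ μ) (j : ℕ)
    (hsz : 0 ≤ sz ∧ sz ≤ c₁ * ε₁ * ((L ^ (j + 1))⁻¹) ^ 2)
    (hω : 0 ≤ ω ∧ ω ≤ c₂ * ε₁ * ((L ^ (j + 1))⁻¹) ^ 2 * h)
    (hρb : 0 ≤ ρb ∧ ρb ≤ c₃ * ε₁ ^ 2 * ((L ^ j)⁻¹) ^ 4) (hN0 : 0 ≤ N)
    (hN : N * ((L ^ j)⁻¹) ^ 4 ≤ n₀ * (vol * μ)) :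
    N * ((L ^ 2) ^ 2 * ω ^ 2 / 4 + L ^ 2 * sz * ρb + q * (L ^ 2 * sz + ρb) ^ 4)
      ≤ vol * (n₀ * (μ * (c₂ ^ 2 * ε₁ ^ 2 / 4 * h ^ 2
          + (c₁ * c₃ * ε₁ ^ 3 + q * (c₁ * ε₁ + c₃ * ε₁ ^ 2) ^ 4) * ((L ^ 2)⁻¹) ^ j))) := by
  obtain ⟨ha0, ha1, _, _, hrb, hξ⟩ := scale_facts hL j
  have hP := interpolationSize_le_profile (q := q) (r := L ^ 2) (n₀ := n₀) (vol := vol * μ) (h := h) hq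
    (by positivity) hn₀ (mul_nonneg hvol hμ) hc₁ hc₃ hε₁ ha0 ha1 hrb hsz.1 hsz.2 hω.1 hω.2 hρb.1 hρb.2 hN0 hN
  rw [← hξ]
  calc _ ≤ vol * μ * (n₀ * (c₂ ^ 2 * ε₁ ^ 2 / 4 * h ^ 2
          + (c₁ * c₃ * ε₁ ^ 3 + q * (c₁ * ε₁ + c₃ * ε₁ ^ 2) ^ 4) * ((L ^ j)⁻¹) ^ 2)) := hP
    _ = _ := by ring

/-- **THE HETEROGENEOUS (U) BOUND AT ONE CUTOFF, PROFILE FORM.**  As `TermwiseHeterogeneous.interpolationError_le_levels`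
(one classical step, windows graded by levels `≤ K`, level-`j` radii at scale `L^{−j}`, level counts in level-`j`
units `≤ n₀·vol·μ_j`), with the oscillation law `ω_j ≤ c₂ε₁L^{−2(j+1)}·h_j` for a PROFILE `h` in place of the
endpoint `h_j = L^{−j}`: `Σ_x e(φ x) − Σ_y e(ψ y) ≤ vol·n₀·Σ_{j≤K} μ_j·(c₂²ε₁²/4·h_j² + C₂·(L⁻²)^j)`. [folklore] -/
theorem interpolationError_le_levels_profile (P : Finset X) (P' : Finset Y) {w : Y → X → ℝ} {Φ : Y → X → V}
    {φ : X → V} {ψ : Y → V} {e : V → ℝ} {q L n₀ vol c₁ c₂ c₃ ε₁ : ℝ} (lvl : Y → ℕ) (K : ℕ)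
    {sz ω ρb N μ h : ℕ → ℝ}
    (he : ∀ v, ‖v‖ ^ 2 / 2 - q * ‖v‖ ^ 4 ≤ e v ∧ e v ≤ ‖v‖ ^ 2 / 2) (hq : 0 ≤ q) (hL : 1 < L)
    (hw : ∀ y ∈ P', ∀ x ∈ P, 0 ≤ w y x) (hrow : ∀ y ∈ P', ∑ x ∈ P, w y x = L ^ 2)
    (hcol : ∀ x ∈ P, ∑ y ∈ P', w y x = (L ^ 2)⁻¹) (hΦ : ∀ y ∈ P', ∀ x ∈ P, ‖Φ y x‖ = ‖φ x‖)
    (hlvl : ∀ y ∈ P', lvl y ≤ K)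
    (hszw : ∀ y ∈ P', ∀ x ∈ P, 0 < w y x → ‖φ x‖ ≤ sz (lvl y))
    (hoscw : ∀ y ∈ P', ∀ x ∈ P, ∀ x' ∈ P, 0 < w y x → 0 < w y x' → ‖Φ y x - Φ y x'‖ ≤ ω (lvl y))
    (hρw : ∀ y ∈ P', ‖ψ y - ∑ x ∈ P, w y x • Φ y x‖ ≤ ρb (lvl y))
    (hn₀ : 0 ≤ n₀) (hvol : 0 ≤ vol) (hc₁ : 0 ≤ c₁) (hc₃ : 0 ≤ c₃) (hε₁ : 0 ≤ ε₁)
    (hsz : ∀ j, 0 ≤ sz j ∧ sz j ≤ c₁ * ε₁ * ((L ^ (j + 1))⁻¹) ^ 2)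
    (hω : ∀ j, 0 ≤ ω j ∧ ω j ≤ c₂ * ε₁ * ((L ^ (j + 1))⁻¹) ^ 2 * h j)
    (hρb : ∀ j, 0 ≤ ρb j ∧ ρb j ≤ c₃ * ε₁ ^ 2 * ((L ^ j)⁻¹) ^ 4)
    (hμ : ∀ j, 0 ≤ μ j) (hN0 : ∀ j, 0 ≤ N j)
    (hNc : ∀ j ≤ K, ((P'.filter (fun y => lvl y = j)).card : ℝ) ≤ N j)
    (hN : ∀ j ≤ K, N j * ((L ^ j)⁻¹) ^ 4 ≤ n₀ * (vol * μ j)) :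
    ∑ x ∈ P, e (φ x) - ∑ y ∈ P', e (ψ y)
      ≤ vol * (n₀ * ∑ j ∈ Finset.range (K + 1), μ j * (c₂ ^ 2 * ε₁ ^ 2 / 4 * h j ^ 2
          + (c₁ * c₃ * ε₁ ^ 3 + q * (c₁ * ε₁ + c₃ * ε₁ ^ 2) ^ 4) * ((L ^ 2)⁻¹) ^ j)) := by
  have hL0 : 0 < L := by linarith
  have hrc : (1 : ℝ) ≤ L ^ 2 * (L ^ 2)⁻¹ := by rw [mul_inv_cancel₀ (pow_ne_zero 2 hL0.ne')]
  have h1 := interpolationError_le_of_profiles P P' (sz := fun y => sz (lvl y)) (osc := fun y => ω (lvl y))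
    (ρ := fun y => ρb (lvl y)) he hq hw hrow hcol hrc hΦ hszw hoscw (fun y _ => (hρb _).1) hρw
  have hG : ∀ j, 0 ≤ (L ^ 2) ^ 2 * ω j ^ 2 / 4 + L ^ 2 * sz j * ρb j + q * (L ^ 2 * sz j + ρb j) ^ 4 := fun j => by
    have := (hsz j).1; have := (hω j).1; have := (hρb j).1; positivity
  have h2 := sum_le_sum_levels P' lvl K hlvl hG (F := fun y =>
      (L ^ 2) ^ 2 * ω (lvl y) ^ 2 / 4 + L ^ 2 * sz (lvl y) * ρb (lvl y) + q * (L ^ 2 * sz (lvl y) + ρb (lvl y)) ^ 4)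
    (fun y _ => le_rfl) hNc
  have h3 : ∑ j ∈ Finset.range (K + 1),
        N j * ((L ^ 2) ^ 2 * ω j ^ 2 / 4 + L ^ 2 * sz j * ρb j + q * (L ^ 2 * sz j + ρb j) ^ 4)
      ≤ ∑ j ∈ Finset.range (K + 1), vol * (n₀ * (μ j * (c₂ ^ 2 * ε₁ ^ 2 / 4 * h j ^ 2
          + (c₁ * c₃ * ε₁ ^ 3 + q * (c₁ * ε₁ + c₃ * ε₁ ^ 2) ^ 4) * ((L ^ 2)⁻¹) ^ j))) :=
    Finset.sum_le_sum fun j hj => levelShareP_le hq hL hn₀ hvol hc₁ hc₃ hε₁ (hμ j) j (hsz j) (hω j) (hρb j) (hN0 j)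
      (hN j (Nat.le_of_lt_succ (Finset.mem_range.mp hj)))
  rw [Finset.mul_sum, Finset.mul_sum]
  exact h1.trans (h2.trans h3)

/-- The two window sums of the profile census: with the count shares of the window clause and a GEOMETRIC profile
`h_j = ϑ^j`, `Σ_{j≤K} [j⋆ ≤ j]Λ^{K−j}·(C₁(ϑ^j)² + C₂θ^j) ≤ C₁·windowSum ϑ² Λ j⋆ K + C₂·windowSum θ Λ j⋆ K`
(`0 ≤ C₁, C₂, ϑ, θ`). [folklore] -/
theorem sum_shares_profile_le {ϑ θ Λ C₁ C₂ : ℝ} (hC₁ : 0 ≤ C₁) (hC₂ : 0 ≤ C₂) (hϑ : 0 ≤ ϑ) (hθ : 0 ≤ θ)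
    (j₀ K : ℕ) :
    ∑ j ∈ Finset.range (K + 1), (if j₀ ≤ j then Λ ^ (K - j) else 0) * (C₁ * (ϑ ^ j) ^ 2 + C₂ * θ ^ j)
      ≤ C₁ * windowSum (ϑ ^ 2) Λ j₀ K + C₂ * windowSum θ Λ j₀ K := by
  have e1 : ∀ j : ℕ, (ϑ ^ j) ^ 2 = (ϑ ^ 2) ^ j := fun j => by rw [← pow_mul, ← pow_mul, mul_comm]
  have hsplit : ∑ j ∈ Finset.range (K + 1), (if j₀ ≤ j then Λ ^ (K - j) else 0) * (C₁ * (ϑ ^ j) ^ 2 + C₂ * θ ^ j)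
      = C₁ * ∑ j ∈ Finset.range (K + 1), (if j₀ ≤ j then Λ ^ (K - j) else 0) * (ϑ ^ 2) ^ j
        + C₂ * ∑ j ∈ Finset.range (K + 1), (if j₀ ≤ j then Λ ^ (K - j) else 0) * θ ^ j := by
    rw [Finset.mul_sum, Finset.mul_sum, ← Finset.sum_add_distrib]
    exact Finset.sum_congr rfl fun j _ => by rw [e1]; ring
  rw [hsplit]
  exact add_le_add (mul_le_mul_of_nonneg_left (sum_shares_le_windowSum (pow_nonneg hϑ 2) j₀ K) hC₁)
    (mul_le_mul_of_nonneg_left (sum_shares_le_windowSum hθ j₀ K) hC₂)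

end HeterogeneousP

/-! ## §13 (U) and (L) PRODUCED along the tower from LEVEL-GRADED radii WITH A GEOMETRIC OSCILLATION PROFILE under the
window clause -/

section IndexedP

variable {V : Type*} [NormedAddCommGroup V] [InnerProductSpace ℝ V] {Xf Xc : Type*} {ι : Type} {σ : Type*}
  [DecidableEq σ] {l₀ vol : ℝ} {T : ℕ → Finset σ} {Bad : ℕ → ℝ → Finset σ} {Adm : Set ι}

/-- **(U)(L) PRODUCED FROM LEVEL-GRADED ONE-STEP REGULARITY UNDER THE WINDOW CLAUSE, HÖLDER PROFILE.**  As
`interpolation_averaging_of_levels`, with ONE binder re-typed: the oscillation law is `ω_j ≤ c₂ε₁L^{−2(j+1)}·ϑ^j` for a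
geometric profile `0 < ϑ < 1` (the Hölder exponent `β₀` of the printed background regularity: `ϑ = L^{−β₀}`; the
endpoint `ϑ = L⁻¹` is `β₀ = 1`) in place of `…·L^{−j}`.  OUTPUT: generation 9's six binders with
`dU_K = n₀·(c₂²ε₁²/4·windowSum ϑ² L⁴ (jlogOf Cl K) K + C₂·windowSum L⁻² L⁴ (jlogOf Cl K) K)` — the variance share at
the SLOW rate `ϑ²` (still `poly(K)·ϑ^{2K}`, summable for every `ϑ < 1` by the tree's `summable_windowSum_log`) — and
`dL_K = n₀·C_L·windowSum L⁻² L⁴ (jlogOf Cl K) K` unchanged. [folklore] -/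
theorem interpolation_averaging_of_levels_profile {Y YA : Type*} {g : ℕ → ℝ → σ → ι → YA → ℝ}
    {f₁ : ℕ → ℝ → σ → ι → Y → ℝ} {Q : ℕ → ℝ → σ → ι → Y → YA} {yA yB : ℕ → ℝ → σ → ι → Y}
    {xA : ℕ → ℝ → σ → ι → YA} {Pf : ℕ → Finset Xf} {Pc : ℕ → Finset Xc} {w : ℕ → Xc → Xf → ℝ} {e : V → ℝ}
    {φA φB : ℕ → ℝ → σ → ι → Xf → V} {ψA ψB : ℕ → ℝ → σ → ι → Xc → V} {ΦA ΦB : ℕ → ℝ → σ → ι → Xc → Xf → V}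
    {lvlA lvlB : ℕ → ℝ → σ → ι → Xc → ℕ} {lvlBf : ℕ → ℝ → σ → ι → Xf → ℕ}
    {q₄ L n₀ c₁ c₂ c₃ ε₁ Cl ϑ : ℝ} {sz ω ρb : ℕ → ℝ}
    (he : ∀ v, ‖v‖ ^ 2 / 2 - q₄ * ‖v‖ ^ 4 ≤ e v ∧ e v ≤ ‖v‖ ^ 2 / 2) (hq₄ : 0 ≤ q₄) (hL : 1 < L)
    (hw : ∀ K, ∀ y ∈ Pc K, ∀ x ∈ Pf K, 0 ≤ w K y x) (hrow : ∀ K, ∀ y ∈ Pc K, ∑ x ∈ Pf K, w K y x = L ^ 2)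
    (hcol : ∀ K, ∀ x ∈ Pf K, ∑ y ∈ Pc K, w K y x = (L ^ 2)⁻¹) (hn₀ : 0 ≤ n₀) (hvol : 0 ≤ vol)
    (hNf : ∀ K, ((Pf K).card : ℝ) ≤ n₀ * vol * (L ^ (K + 1)) ^ 4)
    (hNc : ∀ K, ((Pc K).card : ℝ) ≤ n₀ * vol * (L ^ K) ^ 4)
    (hreprU : ∀ K t, |t| ≤ l₀ → ∀ τ ∈ T K \ Bad K t, ∀ v ∈ Adm,
      f₁ K t τ v (yA K t τ v) = ∑ x ∈ Pf K, e (φA K t τ v x) ∧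
        g K t τ v (xA K t τ v) = ∑ y ∈ Pc K, e (ψA K t τ v y))
    (hΦA : ∀ K t, |t| ≤ l₀ → ∀ τ ∈ T K \ Bad K t, ∀ v ∈ Adm, ∀ y ∈ Pc K, ∀ x ∈ Pf K,
      ‖ΦA K t τ v y x‖ = ‖φA K t τ v x‖)
    (hwinA : ∀ K t, |t| ≤ l₀ → ∀ τ ∈ T K \ Bad K t, ∀ v ∈ Adm, RecentOnly (Pc K) (lvlA K t τ v) (jlogOf Cl K) K)
    (hρA : ∀ K t, |t| ≤ l₀ → ∀ τ ∈ T K \ Bad K t, ∀ v ∈ Adm, ∀ y ∈ Pc K,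
      ‖ψA K t τ v y - ∑ x ∈ Pf K, w K y x • ΦA K t τ v y x‖ ≤ ρb (lvlA K t τ v y))
    (hsA : ∀ K t, |t| ≤ l₀ → ∀ τ ∈ T K \ Bad K t, ∀ v ∈ Adm, ∀ y ∈ Pc K, ∀ x ∈ Pf K,
      0 < w K y x → ‖φA K t τ v x‖ ≤ sz (lvlA K t τ v y))
    (hoscA : ∀ K t, |t| ≤ l₀ → ∀ τ ∈ T K \ Bad K t, ∀ v ∈ Adm, ∀ y ∈ Pc K, ∀ x ∈ Pf K, ∀ x' ∈ Pf K,
      0 < w K y x → 0 < w K y x' → ‖ΦA K t τ v y x - ΦA K t τ v y x'‖ ≤ ω (lvlA K t τ v y))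
    (hreprL : ∀ K t, |t| ≤ l₀ → ∀ τ ∈ T K \ Bad K t, ∀ v ∈ Adm,
      f₁ K t τ v (yB K t τ v) = ∑ x ∈ Pf K, e (φB K t τ v x) ∧
        g K t τ v (Q K t τ v (yB K t τ v)) = ∑ y ∈ Pc K, e (ψB K t τ v y))
    (hΦB : ∀ K t, |t| ≤ l₀ → ∀ τ ∈ T K \ Bad K t, ∀ v ∈ Adm, ∀ y ∈ Pc K, ∀ x ∈ Pf K,
      ‖ΦB K t τ v y x‖ = ‖φB K t τ v x‖)
    (hwinB : ∀ K t, |t| ≤ l₀ → ∀ τ ∈ T K \ Bad K t, ∀ v ∈ Adm, RecentOnly (Pc K) (lvlB K t τ v) (jlogOf Cl K) K)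
    (hwinBf : ∀ K t, |t| ≤ l₀ → ∀ τ ∈ T K \ Bad K t, ∀ v ∈ Adm,
      RecentOnly (Pf K) (lvlBf K t τ v) (jlogOf Cl K) K)
    (hρB : ∀ K t, |t| ≤ l₀ → ∀ τ ∈ T K \ Bad K t, ∀ v ∈ Adm, ∀ y ∈ Pc K,
      ‖ψB K t τ v y - ∑ x ∈ Pf K, w K y x • ΦB K t τ v y x‖ ≤ ρb (lvlB K t τ v y))
    (hsB : ∀ K t, |t| ≤ l₀ → ∀ τ ∈ T K \ Bad K t, ∀ v ∈ Adm, ∀ y ∈ Pc K, ∀ x ∈ Pf K,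
      0 < w K y x → ‖φB K t τ v x‖ ≤ sz (lvlB K t τ v y))
    (hsBf : ∀ K t, |t| ≤ l₀ → ∀ τ ∈ T K \ Bad K t, ∀ v ∈ Adm, ∀ x ∈ Pf K, ‖φB K t τ v x‖ ≤ sz (lvlBf K t τ v x))
    (hc₁ : 0 ≤ c₁) (hc₃ : 0 ≤ c₃) (hε₁ : 0 ≤ ε₁) (hCl : 0 ≤ Cl) (hϑ0 : 0 < ϑ) (hϑ1 : ϑ < 1)
    (hsz : ∀ j, 0 ≤ sz j ∧ sz j ≤ c₁ * ε₁ * ((L ^ (j + 1))⁻¹) ^ 2)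
    (hω : ∀ j, 0 ≤ ω j ∧ ω j ≤ c₂ * ε₁ * ((L ^ (j + 1))⁻¹) ^ 2 * ϑ ^ j)
    (hρb : ∀ j, 0 ≤ ρb j ∧ ρb j ≤ c₃ * ε₁ ^ 2 * ((L ^ j)⁻¹) ^ 4) :
    (∀ K t, |t| ≤ l₀ → ∀ τ ∈ T K \ Bad K t, ∀ v ∈ Adm,
      f₁ K t τ v (yA K t τ v) - g K t τ v (xA K t τ v)
        ≤ vol * (n₀ * (c₂ ^ 2 * ε₁ ^ 2 / 4 * windowSum (ϑ ^ 2) (L ^ 4) (jlogOf Cl K) K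
            + (c₁ * c₃ * ε₁ ^ 3 + q₄ * (c₁ * ε₁ + c₃ * ε₁ ^ 2) ^ 4) * windowSum ((L ^ 2)⁻¹) (L ^ 4) (jlogOf Cl K) K))) ∧
    (∀ K t, |t| ≤ l₀ → ∀ τ ∈ T K \ Bad K t, ∀ v ∈ Adm,
      g K t τ v (Q K t τ v (yB K t τ v)) - f₁ K t τ v (yB K t τ v)
        ≤ vol * (n₀ * (c₁ * c₃ * ε₁ ^ 3 + c₃ ^ 2 * ε₁ ^ 4 / 2 + q₄ * (c₁ ^ 4 * ε₁ ^ 4))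
          * windowSum ((L ^ 2)⁻¹) (L ^ 4) (jlogOf Cl K) K)) ∧
    (∀ K, 0 ≤ n₀ * (c₂ ^ 2 * ε₁ ^ 2 / 4 * windowSum (ϑ ^ 2) (L ^ 4) (jlogOf Cl K) K
            + (c₁ * c₃ * ε₁ ^ 3 + q₄ * (c₁ * ε₁ + c₃ * ε₁ ^ 2) ^ 4) * windowSum ((L ^ 2)⁻¹) (L ^ 4) (jlogOf Cl K) K)) ∧
    (∀ K, 0 ≤ n₀ * (c₁ * c₃ * ε₁ ^ 3 + c₃ ^ 2 * ε₁ ^ 4 / 2 + q₄ * (c₁ ^ 4 * ε₁ ^ 4))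
      * windowSum ((L ^ 2)⁻¹) (L ^ 4) (jlogOf Cl K) K) ∧
    Summable (fun K => n₀ * (c₂ ^ 2 * ε₁ ^ 2 / 4 * windowSum (ϑ ^ 2) (L ^ 4) (jlogOf Cl K) K
            + (c₁ * c₃ * ε₁ ^ 3 + q₄ * (c₁ * ε₁ + c₃ * ε₁ ^ 2) ^ 4) * windowSum ((L ^ 2)⁻¹) (L ^ 4) (jlogOf Cl K) K)) ∧
    Summable (fun K => n₀ * (c₁ * c₃ * ε₁ ^ 3 + c₃ ^ 2 * ε₁ ^ 4 / 2 + q₄ * (c₁ ^ 4 * ε₁ ^ 4))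
      * windowSum ((L ^ 2)⁻¹) (L ^ 4) (jlogOf Cl K) K) := by
  obtain ⟨hθ0, hθ1, hΛ1⟩ := rate_facts hL
  have hΛ0 : (0 : ℝ) ≤ L ^ 4 := zero_le_one.trans hΛ1
  have hϑ2 : 0 < ϑ ^ 2 := by positivity
  have hϑ21 : ϑ ^ 2 < 1 := pow_lt_one₀ hϑ0.le hϑ1 two_ne_zero
  have hC₁ : 0 ≤ c₂ ^ 2 * ε₁ ^ 2 / 4 := by positivity
  have hC₂ : 0 ≤ c₁ * c₃ * ε₁ ^ 3 + q₄ * (c₁ * ε₁ + c₃ * ε₁ ^ 2) ^ 4 := by positivity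
  have hCL : 0 ≤ c₁ * c₃ * ε₁ ^ 3 + c₃ ^ 2 * ε₁ ^ 4 / 2 + q₄ * (c₁ ^ 4 * ε₁ ^ 4) := by positivity
  have hW : ∀ K, 0 ≤ windowSum ((L ^ 2)⁻¹) (L ^ 4) (jlogOf Cl K) K := fun K => windowSum_nonneg hθ0.le hΛ0 _ _
  have hWϑ : ∀ K, 0 ≤ windowSum (ϑ ^ 2) (L ^ 4) (jlogOf Cl K) K := fun K => windowSum_nonneg hϑ2.le hΛ0 _ _
  have hsum := summable_windowSum_log hθ0 hθ1 hΛ1 hCl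
  have hsumϑ := summable_windowSum_log hϑ2 hϑ21 hΛ1 hCl
  have hμ0 : ∀ K j, 0 ≤ (if jlogOf Cl K ≤ j then (L ^ 4) ^ (K - j) else (0 : ℝ)) := fun K j => by
    split_ifs
    · exact pow_nonneg hΛ0 _
    · exact le_rfl
  have hS : ∀ K, ∑ j ∈ Finset.range (K + 1), (if jlogOf Cl K ≤ j then (L ^ 4) ^ (K - j) else (0 : ℝ))
      * ((L ^ 2)⁻¹) ^ j ≤ windowSum ((L ^ 2)⁻¹) (L ^ 4) (jlogOf Cl K) K :=
    fun K => sum_shares_le_windowSum hθ0.le _ _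
  have hSP : ∀ K, ∑ j ∈ Finset.range (K + 1), (if jlogOf Cl K ≤ j then (L ^ 4) ^ (K - j) else (0 : ℝ))
      * (c₂ ^ 2 * ε₁ ^ 2 / 4 * (ϑ ^ j) ^ 2 + (c₁ * c₃ * ε₁ ^ 3 + q₄ * (c₁ * ε₁ + c₃ * ε₁ ^ 2) ^ 4) * ((L ^ 2)⁻¹) ^ j)
      ≤ c₂ ^ 2 * ε₁ ^ 2 / 4 * windowSum (ϑ ^ 2) (L ^ 4) (jlogOf Cl K) K
        + (c₁ * c₃ * ε₁ ^ 3 + q₄ * (c₁ * ε₁ + c₃ * ε₁ ^ 2) ^ 4) * windowSum ((L ^ 2)⁻¹) (L ^ 4) (jlogOf Cl K) K :=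
    fun K => sum_shares_profile_le hC₁ hC₂ hϑ0.le hθ0.le _ _
  refine ⟨fun K t ht τ hτ v hv => ?_, fun K t ht τ hτ v hv => ?_,
    fun K => mul_nonneg hn₀ (add_nonneg (mul_nonneg hC₁ (hWϑ K)) (mul_nonneg hC₂ (hW K))),
    fun K => mul_nonneg (mul_nonneg hn₀ hCL) (hW K), ?_, hsum.mul_left _⟩
  · obtain ⟨e1, e2⟩ := hreprU K t ht τ hτ v hv
    have hrec := hwinA K t ht τ hτ v hv
    have key := interpolationError_le_levels_profile (Pf K) (Pc K) (lvl := lvlA K t τ v) (K := K)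
      (N := fun j => (((Pc K).filter (fun y => lvlA K t τ v y = j)).card : ℝ))
      (μ := fun j => if jlogOf Cl K ≤ j then (L ^ 4) ^ (K - j) else (0 : ℝ)) (h := fun j => ϑ ^ j)
      he hq₄ hL (hw K) (hrow K) (hcol K) (hΦA K t ht τ hτ v hv) (fun y hy => (hrec y hy).2)
      (hsA K t ht τ hτ v hv) (hoscA K t ht τ hτ v hv) (hρA K t ht τ hτ v hv) hn₀ hvol hc₁ hc₃ hε₁ hsz hω hρb
      (hμ0 K) (fun j => Nat.cast_nonneg _) (fun j _ => le_rfl)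
      (fun j hj => levelCount_coarse_le (Pc K) (lvlA K t τ v) hL hj hrec (hNc K))
    rw [e1, e2]
    exact key.trans (mul_le_mul_of_nonneg_left (mul_le_mul_of_nonneg_left (hSP K) hn₀) hvol)
  · obtain ⟨e1, e2⟩ := hreprL K t ht τ hτ v hv
    have hrec := hwinB K t ht τ hτ v hv
    have hrecf := hwinBf K t ht τ hτ v hv
    have key := averagingError_le_levels (Pf K) (Pc K) (lvl := lvlB K t τ v) (lvlf := lvlBf K t τ v) (K := K)
      (Nc := fun j => (((Pc K).filter (fun y => lvlB K t τ v y = j)).card : ℝ))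
      (Nf := fun j => (((Pf K).filter (fun x => lvlBf K t τ v x = j)).card : ℝ))
      (μ := fun j => if jlogOf Cl K ≤ j then (L ^ 4) ^ (K - j) else (0 : ℝ))
      he hq₄ hL (hw K) (hrow K) (hcol K) (hΦB K t ht τ hτ v hv) (fun y hy => (hrec y hy).2)
      (fun x hx => (hrecf x hx).2) (hsB K t ht τ hτ v hv) (hsBf K t ht τ hτ v hv) (hρB K t ht τ hτ v hv)
      hn₀ hvol hc₁ hc₃ hε₁ hsz hρb (hμ0 K) (fun j => Nat.cast_nonneg _) (fun j => Nat.cast_nonneg _)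
      (fun j _ => le_rfl) (fun j _ => le_rfl)
      (fun j hj => levelCount_coarse_le (Pc K) (lvlB K t τ v) hL hj hrec (hNc K))
      (fun j hj => levelCount_fine_le (Pf K) (lvlBf K t τ v) hL hj hrecf (hNf K))
    rw [e1, e2]
    exact key.trans (mul_le_mul_of_nonneg_left (mul_le_mul_of_nonneg_left (hS K) (mul_nonneg hn₀ hCL)) hvol)
  · exact ((hsumϑ.mul_left _).add (hsum.mul_left _)).mul_left n₀

end IndexedP

end Summit.QuantumFields.BalabanUV.T4Continuum.TermwiseLevels
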